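import Mathlib.NumberTheory.Padics.Hensel
import Mathlib.NumberTheory.Padics.RingHoms
import Mathlib.RingTheory.Ideal.Norm.AbsNorm
import Literature.NumberTheory.NumberFields.CubicFieldExplicit
import Summits.BirchSwinnertonDyer.BirchSwinnertonDyer.Theorems.Rank2Observatory2DescLinGens
import HarnessLib

/-!
# KERNEL-2DESC-CL, dyadic / `p`-adic ROOT VIEW (part D1): a Hensel certificate for a simple `ℤ_p`-root of the cubic

HONEST FRAMING: per-curve certified theorems and census instruments; no claim on BSD in rank ≥ 2.

For the 73 complex cubic `2`-division fields with common index divisor `2` (`2` totally split, every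
primitive integer has even index — `generics/q2m/census/etacensus_j223295.json`: no `η` of odd index exists)
neither the `α`-view nor an `η`-view has prime rows above `2`.  The third view is LOCAL: a prime of `𝓞 K`
above `p` of residue degree `1` is the kernel of `x ↦ x(ρ) mod p` for a root `ρ ∈ ℤ_p` of the cubic, and such a
root is certified by integer arithmetic (Hensel).  This file is the certificate and its soundness:

* `henselCheck A B C p a d N` (decidable): `p^d ∥ F'(a)`, `p^(N+d) ∣ F(a)`, `d + 2 ≤ N`;
* `exists_root_of_henselCheck`: then there is `z : ℤ_[p]` with `F(z) = 0` and `‖z - a‖ ≤ p^(-N)`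
  (Hensel's lemma `hensels_lemma` of Mathlib plus the precision bookkeeping by the binomial expansion);
* `embOfRoot`: the ring map `K →+* ℚ_[p]`, `θ ↦ z`, through the power basis `1, θ, θ²` (`MonicCubic.pb`), and
  `embOfRoot_theta`.

Parts D2–D3 (separate files): integrality `𝓞 K → ℤ_[p]`, the degree-one prime `ker (toZMod ∘ ·)`, its norm,
membership / non-membership of `X(θ)/m` read from `X(a) mod p^(v_p(m)+1)`, and `(2) = P₁P₂P₃` from three
pairwise-separated certificates.  [folklore]
-/

noncomputable section

set_option linter.dupNamespace false

open Polynomial NumberField Literature.NumberTheory.NumberFields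

namespace Summit.BirchSwinnertonDyer.BirchSwinnertonDyer.Rank2Observatory.TwoDescPadic

/-! ## The certificate -/

/-- `F(a) = a³ + Aa² + Ba + C`. -/
def cubicEval (A B C a : ℤ) : ℤ := a ^ 3 + A * a ^ 2 + B * a + C

/-- `F'(a) = 3a² + 2Aa + B`. -/
def cubicDerivEval (A B a : ℤ) : ℤ := 3 * a ^ 2 + 2 * A * a + B

/-- **Hensel certificate** for a simple `ℤ_p`-root near the integer `a`: `p^d ∣ F'(a)`, `p^(d+1) ∤ F'(a)`,
`p^(N+d) ∣ F(a)` and `d + 2 ≤ N`.  Decidable integer arithmetic. [folklore] -/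
def henselCheck (A B C : ℤ) (p : ℕ) (a : ℤ) (d N : ℕ) : Bool :=
  decide (d + 2 ≤ N) && decide (((p : ℤ) ^ d) ∣ cubicDerivEval A B a) &&
    !decide (((p : ℤ) ^ (d + 1)) ∣ cubicDerivEval A B a) && decide (((p : ℤ) ^ (N + d)) ∣ cubicEval A B C a)

section Sound

variable {A B C : ℤ} {p : ℕ} {a : ℤ} {d N : ℕ}

/-- A passed `henselCheck` has precision `N ≥ d + 2` (first conjunct). -/
theorem le_of_henselCheck (h : henselCheck A B C p a d N = true) : d + 2 ≤ N := by
  simp only [henselCheck, Bool.and_eq_true, decide_eq_true_eq] at h; exact h.1.1.1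

/-- A passed `henselCheck` gives `p ^ d ∣ f'(a)` for the cubic's derivative at the approximate root `a`. -/
theorem dvd_deriv_of_henselCheck (h : henselCheck A B C p a d N = true) :
    ((p : ℤ) ^ d) ∣ cubicDerivEval A B a := by
  simp only [henselCheck, Bool.and_eq_true, decide_eq_true_eq] at h; exact h.1.1.2

/-- A passed `henselCheck` gives `¬ p ^ (d + 1) ∣ f'(a)`: the derivative has valuation exactly `d` at `a`. -/
theorem not_dvd_deriv_of_henselCheck (h : henselCheck A B C p a d N = true) :
    ¬ ((p : ℤ) ^ (d + 1)) ∣ cubicDerivEval A B a := by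
  simp only [henselCheck, Bool.and_eq_true, Bool.not_eq_true', decide_eq_false_iff_not,
    decide_eq_true_eq] at h
  exact h.1.2

/-- A passed `henselCheck` gives `p ^ (N + d) ∣ f(a)`: `a` is a root to precision `N + d`. -/
theorem dvd_eval_of_henselCheck (h : henselCheck A B C p a d N = true) :
    ((p : ℤ) ^ (N + d)) ∣ cubicEval A B C a := by
  simp only [henselCheck, Bool.and_eq_true, decide_eq_true_eq] at h; exact h.2

/-- The cubic as a polynomial over `ℤ_[p]`. -/
def cubicP (A B C : ℤ) (p : ℕ) [Fact p.Prime] : Polynomial ℤ_[p] :=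
  X ^ 3 + Polynomial.C (A : ℤ_[p]) * X ^ 2 + Polynomial.C (B : ℤ_[p]) * X + Polynomial.C (C : ℤ_[p])

/-- Evaluation of `cubicP A B C p` at `z : ℤ_[p]`, expanded. -/
theorem eval_cubicP [Fact p.Prime] (z : ℤ_[p]) :
    (cubicP A B C p).eval z = z ^ 3 + (A : ℤ_[p]) * z ^ 2 + (B : ℤ_[p]) * z + (C : ℤ_[p]) := by
  simp [cubicP]

/-- Evaluation of the derivative of `cubicP A B C p` at `z : ℤ_[p]`, expanded. -/
theorem eval_derivative_cubicP [Fact p.Prime] (z : ℤ_[p]) :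
    (cubicP A B C p).derivative.eval z = 3 * z ^ 2 + 2 * (A : ℤ_[p]) * z + (B : ℤ_[p]) := by
  simp [cubicP, derivative_mul]
  ring

/-- `cubicP` evaluated at an integer is the cast of the integer evaluation `cubicEval`. -/
theorem eval_cubicP_intCast [Fact p.Prime] (a : ℤ) :
    (cubicP A B C p).eval (a : ℤ_[p]) = ((cubicEval A B C a : ℤ) : ℤ_[p]) := by
  simp [eval_cubicP, cubicEval]

/-- The derivative of `cubicP` evaluated at an integer is the cast of `cubicDerivEval`. -/
theorem eval_derivative_cubicP_intCast [Fact p.Prime] (a : ℤ) :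
    (cubicP A B C p).derivative.eval (a : ℤ_[p]) = ((cubicDerivEval A B a : ℤ) : ℤ_[p]) := by
  simp [eval_derivative_cubicP, cubicDerivEval]

/-- `aeval` form (Mathlib's `hensels_lemma` is stated with `aeval`). -/
theorem aeval_cubicP [Fact p.Prime] (z : ℤ_[p]) : (cubicP A B C p).aeval z = (cubicP A B C p).eval z := by
  rw [coe_aeval_eq_eval]

variable [hp : Fact p.Prime]

/-- `‖F'(a)‖ = ‖F'(a)‖` pinned between `p^(-d)` and below: `p^(-d) ≤ ‖F'(a)‖` (from `p^(d+1) ∤ F'(a)`). -/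
theorem norm_deriv_ge (h : henselCheck A B C p a d N = true) :
    (p : ℝ) ^ (-(d : ℤ)) ≤ ‖((cubicDerivEval A B a : ℤ) : ℤ_[p])‖ := by
  have hnd := not_dvd_deriv_of_henselCheck h
  by_contra hlt
  push Not at hlt
  have hle : ‖((cubicDerivEval A B a : ℤ) : ℤ_[p])‖ ≤ (p : ℝ) ^ (-((d + 1 : ℕ) : ℤ)) := by
    rw [PadicInt.norm_le_pow_iff_norm_lt_pow_add_one]
    have : (-((d + 1 : ℕ) : ℤ)) + 1 = -(d : ℤ) := by push_cast; ring
    rw [this]; exact hlt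
  exact hnd (PadicInt.norm_int_le_pow_iff_dvd.mp hle)

/-- `‖F(a)‖ ≤ p^(-(N+d))`. -/
theorem norm_eval_le (h : henselCheck A B C p a d N = true) :
    ‖((cubicEval A B C a : ℤ) : ℤ_[p])‖ ≤ (p : ℝ) ^ (-((N + d : ℕ) : ℤ)) :=
  PadicInt.norm_int_le_pow_iff_dvd.mpr (dvd_eval_of_henselCheck h)

/-- The Hensel hypothesis `‖F(a)‖ < ‖F'(a)‖²`. -/
theorem hensel_hyp (h : henselCheck A B C p a d N = true) :
    ‖(cubicP A B C p).aeval (a : ℤ_[p])‖ < ‖(cubicP A B C p).derivative.aeval (a : ℤ_[p])‖ ^ 2 := by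
  rw [coe_aeval_eq_eval, eval_cubicP_intCast, eval_derivative_cubicP_intCast]
  have hp1 : (1 : ℝ) < p := by exact_mod_cast hp.out.one_lt
  have hp0 : (0 : ℝ) < p := by positivity
  have hge := norm_deriv_ge h
  have hle := norm_eval_le h
  have hN := le_of_henselCheck (p := p) h
  have hpos : (0 : ℝ) < (p : ℝ) ^ (-(d : ℤ)) := zpow_pos hp0 _
  calc ‖((cubicEval A B C a : ℤ) : ℤ_[p])‖ ≤ (p : ℝ) ^ (-((N + d : ℕ) : ℤ)) := hle
    _ < (p : ℝ) ^ (-(d : ℤ)) * (p : ℝ) ^ (-(d : ℤ)) := by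
        rw [← zpow_add₀ hp0.ne']
        apply zpow_lt_zpow_right₀ hp1
        push_cast; omega
    _ ≤ ‖((cubicDerivEval A B a : ℤ) : ℤ_[p])‖ * ‖((cubicDerivEval A B a : ℤ) : ℤ_[p])‖ :=
        mul_le_mul hge hge hpos.le (norm_nonneg _)
    _ = ‖((cubicDerivEval A B a : ℤ) : ℤ_[p])‖ ^ 2 := by ring

/-- **A simple `ℤ_p`-root of the cubic within `p^(-N)` of `a`** from the Hensel certificate: Mathlib's
`hensels_lemma` gives the root `z` with `‖z - a‖ < ‖F'(a)‖` and `‖F'(z)‖ = ‖F'(a)‖`; the binomial expansion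
`F(a) = (a - z)(F'(z) + k(a - z))` and the ultrametric inequality give `‖F(a)‖ = ‖a - z‖·‖F'(a)‖`, whence
`‖a - z‖ ≤ p^(-(N+d)) / p^(-d) = p^(-N)`. [folklore] -/
theorem exists_root_of_henselCheck (h : henselCheck A B C p a d N = true) :
    ∃ z : ℤ_[p], (cubicP A B C p).eval z = 0 ∧ ‖z - (a : ℤ_[p])‖ ≤ (p : ℝ) ^ (-(N : ℤ)) := by
  obtain ⟨z, hz, hza, hdz, -⟩ := hensels_lemma (hensel_hyp h)
  rw [coe_aeval_eq_eval] at hz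
  rw [coe_aeval_eq_eval, coe_aeval_eq_eval] at hdz
  rw [coe_aeval_eq_eval] at hza
  refine ⟨z, hz, ?_⟩
  set F := cubicP A B C p with hF
  obtain ⟨k, hk⟩ := F.binomExpansion z ((a : ℤ_[p]) - z)
  have hsum : z + ((a : ℤ_[p]) - z) = a := by ring
  rw [hsum, hz, zero_add] at hk
  have hfac : F.eval (a : ℤ_[p]) =
      ((a : ℤ_[p]) - z) * (F.derivative.eval z + k * ((a : ℤ_[p]) - z)) := by
    rw [hk]; ring
  have hsmall : ‖k * ((a : ℤ_[p]) - z)‖ < ‖F.derivative.eval z‖ := by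
    calc ‖k * ((a : ℤ_[p]) - z)‖ = ‖k‖ * ‖(a : ℤ_[p]) - z‖ := norm_mul _ _
      _ ≤ 1 * ‖(a : ℤ_[p]) - z‖ := mul_le_mul_of_nonneg_right (PadicInt.norm_le_one k) (norm_nonneg _)
      _ = ‖z - (a : ℤ_[p])‖ := by rw [one_mul, norm_sub_rev]
      _ < ‖F.derivative.eval (a : ℤ_[p])‖ := hza
      _ = ‖F.derivative.eval z‖ := hdz.symm
  have hult : ‖F.derivative.eval z + k * ((a : ℤ_[p]) - z)‖ = ‖F.derivative.eval z‖ := by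
    rw [PadicInt.norm_add_eq_max_of_ne (ne_of_gt hsmall), max_eq_left hsmall.le]
  have hnorm : ‖F.eval (a : ℤ_[p])‖ = ‖(a : ℤ_[p]) - z‖ * ‖F.derivative.eval (a : ℤ_[p])‖ := by
    rw [hfac, norm_mul, hult, hdz]
  have hp0 : (0 : ℝ) < p := by exact_mod_cast hp.out.pos
  have hge : (p : ℝ) ^ (-(d : ℤ)) ≤ ‖F.derivative.eval (a : ℤ_[p])‖ := by
    rw [hF, eval_derivative_cubicP_intCast]; exact norm_deriv_ge h
  have hle : ‖F.eval (a : ℤ_[p])‖ ≤ (p : ℝ) ^ (-((N + d : ℕ) : ℤ)) := by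
    rw [hF, eval_cubicP_intCast]; exact norm_eval_le h
  have hpos : (0 : ℝ) < (p : ℝ) ^ (-(d : ℤ)) := zpow_pos hp0 _
  have hsplit : (p : ℝ) ^ (-((N + d : ℕ) : ℤ)) = (p : ℝ) ^ (-(N : ℤ)) * (p : ℝ) ^ (-(d : ℤ)) := by
    rw [← zpow_add₀ hp0.ne']; congr 1; push_cast; ring
  rw [norm_sub_rev]
  have key : ‖(a : ℤ_[p]) - z‖ * (p : ℝ) ^ (-(d : ℤ)) ≤ (p : ℝ) ^ (-(N : ℤ)) * (p : ℝ) ^ (-(d : ℤ)) := by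
    calc ‖(a : ℤ_[p]) - z‖ * (p : ℝ) ^ (-(d : ℤ)) ≤ ‖(a : ℤ_[p]) - z‖ * ‖F.derivative.eval (a : ℤ_[p])‖ :=
          mul_le_mul_of_nonneg_left hge (norm_nonneg _)
      _ = ‖F.eval (a : ℤ_[p])‖ := hnorm.symm
      _ ≤ (p : ℝ) ^ (-(N : ℤ)) * (p : ℝ) ^ (-(d : ℤ)) := by rw [← hsplit]; exact hle
  exact le_of_mul_le_mul_right key hpos

/-- The root relation in the form `z³ + Az² + Bz + C = 0`. -/
theorem root_rel_of_eval {z : ℤ_[p]} (hz : (cubicP A B C p).eval z = 0) :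
    z ^ 3 + (A : ℤ_[p]) * z ^ 2 + (B : ℤ_[p]) * z + (C : ℤ_[p]) = 0 := by
  rw [eval_cubicP] at hz; exact hz

end Sound

/-! ## The embedding `K →+* ℚ_[p]` through a `ℤ_p`-root -/

section Emb

variable {K : Type*} [Field K] [NumberField K] {A B C : ℤ} {θ : K} {p : ℕ} [hp : Fact p.Prime]

/-- **The `p`-adic embedding** `K →+* ℚ_[p]`, `θ ↦ z`, for a root `z ∈ ℤ_[p]` of the (irreducible) cubic,
through the power basis `1, θ, θ²`. [folklore] -/
theorem exists_emb_of_root (hirr : Irreducible (MonicCubic.polyQ A B C))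
    (hθ : aeval θ (MonicCubic.poly A B C) = 0) (h3 : Module.finrank ℚ K = 3) {z : ℤ_[p]}
    (hz : (cubicP A B C p).eval z = 0) :
    ∃ φ : K →+* ℚ_[p], φ θ = (z : ℚ_[p]) := by
  set pb := MonicCubic.pb hirr hθ h3 with hpb
  have hgen : pb.gen = θ := MonicCubic.pb_gen hirr hθ h3
  have hr := root_rel_of_eval hz
  have hy : aeval (z : ℚ_[p]) (minpoly ℚ pb.gen) = 0 := by
    rw [hgen, MonicCubic.minpoly_rat_eq hirr hθ, MonicCubic.polyQ_eq]
    simp only [map_add, map_mul, map_pow, aeval_X, aeval_C, eq_ratCast]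
    push_cast
    have := congrArg ((↑) : ℤ_[p] → ℚ_[p]) hr
    push_cast at this
    linear_combination this
  have hθz : (pb.lift (z : ℚ_[p]) hy).toRingHom θ = z := by
    change pb.lift (z : ℚ_[p]) hy θ = z
    conv_lhs => rw [← hgen]
    exact PowerBasis.lift_gen pb _ hy
  exact ⟨(pb.lift (z : ℚ_[p]) hy).toRingHom, hθz⟩

end Emb

/-! ## Integrality and the degree-one prime `P_φ = ker (x ↦ φ(x) mod p)` -/

section Prime

variable {K : Type*} [Field K] [NumberField K] {p : ℕ} [hp : Fact p.Prime]

set_option linter.unusedSectionVars false in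
/-- **Integrality**: a ring map `φ : K → ℚ_p` sends algebraic integers into `ℤ_p` (an algebraic integer is
integral over `ℤ_p`, which is integrally closed in `ℚ_p`). [folklore] -/
theorem norm_emb_le_one (φ : K →+* ℚ_[p]) (x : 𝓞 K) : ‖φ x‖ ≤ 1 := by
  have hint : IsIntegral ℤ (φ (x : K)) := (RingOfIntegers.isIntegral_coe x).map φ.toIntAlgHom
  have hint' : IsIntegral ℤ_[p] (φ (x : K)) := hint.tower_top
  obtain ⟨y, hy⟩ := IsIntegrallyClosed.isIntegral_iff.mp hint'
  rw [← hy]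
  exact PadicInt.norm_le_one y

/-- The restriction `𝓞 K →+* ℤ_[p]` of `φ`. [folklore] -/
def embInt (φ : K →+* ℚ_[p]) : 𝓞 K →+* ℤ_[p] where
  toFun x := ⟨φ x, norm_emb_le_one φ x⟩
  map_one' := PadicInt.ext (by simp)
  map_mul' x y := PadicInt.ext (by simp)
  map_zero' := PadicInt.ext (by simp)
  map_add' x y := PadicInt.ext (by simp)

/-- The coercion of `embInt φ x : ℤ_[p]` to `ℚ_[p]` is `φ x` (by definition). -/
@[simp] theorem coe_embInt (φ : K →+* ℚ_[p]) (x : 𝓞 K) : ((embInt φ x : ℤ_[p]) : ℚ_[p]) = φ x := rfl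

/-- `embInt φ` preserves the `p`-adic norm: `‖embInt φ x‖ = ‖φ x‖`. -/
theorem norm_embInt (φ : K →+* ℚ_[p]) (x : 𝓞 K) : ‖embInt φ x‖ = ‖φ x‖ := rfl

/-- The residue map `𝓞 K → ℤ_p → 𝔽_p`. [folklore] -/
def resHom (φ : K →+* ℚ_[p]) : 𝓞 K →+* ZMod p := PadicInt.toZMod.comp (embInt φ)

/-- **The prime of `φ`**: `P_φ = ker (𝓞 K → 𝔽_p)`. [folklore] -/
def primeOf (φ : K →+* ℚ_[p]) : Ideal (𝓞 K) := RingHom.ker (resHom φ)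

/-- The residue map `resHom φ : 𝓞 K →+* ZMod p` is surjective. -/
theorem resHom_surjective (φ : K →+* ℚ_[p]) : Function.Surjective (resHom φ) :=
  ZMod.ringHom_surjective (resHom φ)

/-- `P_φ` is maximal. [folklore] -/
theorem primeOf_isMaximal (φ : K →+* ℚ_[p]) : (primeOf φ).IsMaximal :=
  RingHom.ker_isMaximal_of_surjective (resHom φ) (resHom_surjective φ)

/-- `P_φ` is prime. [folklore] -/
theorem primeOf_isPrime (φ : K →+* ℚ_[p]) : (primeOf φ).IsPrime := (primeOf_isMaximal φ).isPrime

/-- **Membership** in `P_φ` is `‖φ x‖ < 1`. [folklore] -/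
theorem mem_primeOf_iff (φ : K →+* ℚ_[p]) (x : 𝓞 K) : x ∈ primeOf φ ↔ ‖φ x‖ < 1 := by
  rw [primeOf, RingHom.mem_ker, resHom, RingHom.comp_apply, ← RingHom.mem_ker, PadicInt.ker_toZMod,
    IsLocalRing.mem_maximalIdeal, mem_nonunits_iff, PadicInt.isUnit_iff, norm_embInt]
  constructor
  · intro h; exact lt_of_le_of_ne (norm_emb_le_one φ x) h
  · intro h; exact ne_of_lt h

/-- `p ∈ P_φ`. [folklore] -/
theorem natCast_mem_primeOf (φ : K →+* ℚ_[p]) : ((p : ℕ) : 𝓞 K) ∈ primeOf φ := by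
  rw [mem_primeOf_iff]
  have h1 : φ ((p : 𝓞 K) : K) = (p : ℚ_[p]) := by simp
  rw [h1]
  exact Padic.norm_p_lt_one

/-- `P_φ ≠ ⊥`. [folklore] -/
theorem primeOf_ne_bot (φ : K →+* ℚ_[p]) : primeOf φ ≠ ⊥ := by
  intro h
  have hm := natCast_mem_primeOf φ
  rw [h, Ideal.mem_bot] at hm
  have : (p : 𝓞 K) ≠ 0 := by exact_mod_cast hp.out.ne_zero
  exact this hm

/-- `P_φ` as a height-one prime. [folklore] -/
def primeOfSpec (φ : K →+* ℚ_[p]) : IsDedekindDomain.HeightOneSpectrum (𝓞 K) :=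
  ⟨primeOf φ, primeOf_isPrime φ, primeOf_ne_bot φ⟩

/-- **Residue degree one**: `N(P_φ) = p`. [folklore] -/
theorem absNorm_primeOf (φ : K →+* ℚ_[p]) : Ideal.absNorm (primeOf φ) = p := by
  rw [Ideal.absNorm_apply, Submodule.cardQuot_apply, primeOf]
  rw [Nat.card_congr (RingHom.quotientKerEquivOfSurjective (resHom_surjective φ)).toEquiv, Nat.card_zmod]

end Prime

end Summit.BirchSwinnertonDyer.BirchSwinnertonDyer.Rank2Observatory.TwoDescPadic
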